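import Summits.CriticalPhenomena.PercolationContinuityZ3.Theorems.PercNearOneGluingNoHeavyLowerTailThreePartitionCubeCheckPacked
import Summits.CriticalPhenomena.PercolationContinuityZ3.Theorems.PercNearOneGluingNoHeavyLowerTailSahiPair43LinkTables

/-!
# Twisted three-partition positivity (★★) = (M⁺-3) on SIX letters: soundness of the checker, V — **the tables of `mkTabs`, bit by bit**

Support file (cell `prim-sahi`, seat `prim-sahi-typer` gen 34; `--supports stmt-CriticalPhenomena-4575`).  Pure proofs, no `sorry`, standard axioms.
Bits of `maskOfN`, of the tables `subT / supT / cmpT / nextT / noBit / full` of `mkTabs m`, of `orTab` / `orBits`, and the lowest-set-bit function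
`lowBit` (= typer gen 31's, `SahiGridPattern.Pair43.lowBit_spec`).  Used by the enumeration-completeness file (`…CubeWalk`). [this work]
-/

namespace Summit.CriticalPhenomena.PercolationContinuityZ3.Theorems.ThreePartition.Cube

open SahiGridPattern.Pair43

/-! ### `maskOfN` -/

/-- Bits of `maskOfN`. [this work] -/
theorem testBit_maskOfN (n : ℕ) (p : ℕ → Bool) (y : ℕ) : (maskOfN n p).testBit y = (decide (y < n) && p y) := by
  unfold maskOfN
  induction n with
  | zero => show (0 : ℕ).testBit y = _; simp
  | succ n ih =>
    show (if p n then foldBelow n (fun k acc => if p k then acc ||| (1 <<< k) else acc) 0 ||| (1 <<< n)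
      else foldBelow n (fun k acc => if p k then acc ||| (1 <<< k) else acc) 0).testBit y = _
    rw [Nat.one_shiftLeft]
    by_cases hyn : y = n
    · subst hyn
      cases hp : p y
      · simp [hp, ih]
      · simp [hp, ih]
    · have e : (y ≤ n) ↔ (y < n) := ⟨fun h => lt_of_le_of_ne h hyn, le_of_lt⟩
      cases hp : p n
      · simp [ih, e]
      · simp [ih, e, Ne.symm hyn]

/-- `maskOfN n p < 2^n`. [this work] -/
theorem maskOfN_lt (n : ℕ) (p : ℕ → Bool) : maskOfN n p < 2 ^ n := by
  refine Nat.lt_pow_two_of_testBit _ fun i hi => ?_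
  rw [testBit_maskOfN]; simp [Nat.not_lt_of_le hi]

/-! ### The tables of `mkTabs` -/

section Tables

variable (m : ℕ)

/-- `(mkTabs m).np`. [this work] -/
theorem np_eq : (mkTabs m).np = 2 ^ m := by show 1 <<< m = 2 ^ m; rw [Nat.one_shiftLeft]

/-- Bits of `subT[a]`: the codes `⊆ a`. [this work] -/
theorem testBit_subT {a : ℕ} (ha : a < 2 ^ m) (b : ℕ) : ((mkTabs m).subT.getD a 0).testBit b = (decide (b < 2 ^ m) && sub b a) := by
  have h1 : (mkTabs m).subT = Array.ofFn fun a : Fin (1 <<< m) => maskOfN (1 <<< m) fun b => sub b a := rfl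
  have ha' : a < 1 <<< m := by rw [Nat.one_shiftLeft]; exact ha
  rw [h1, Array.getD_eq_getD_getElem?, Array.getElem?_ofFn]
  simp only [ha', dif_pos, Option.getD_some]
  rw [testBit_maskOfN, Nat.one_shiftLeft]

/-- Bits of `supT[a]`: the codes `⊇ a`. [this work] -/
theorem testBit_supT {a : ℕ} (ha : a < 2 ^ m) (b : ℕ) : ((mkTabs m).supT.getD a 0).testBit b = (decide (b < 2 ^ m) && sub a b) := by
  have h1 : (mkTabs m).supT = Array.ofFn fun a : Fin (1 <<< m) => maskOfN (1 <<< m) fun b => sub a b := rfl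
  have ha' : a < 1 <<< m := by rw [Nat.one_shiftLeft]; exact ha
  rw [h1, Array.getD_eq_getD_getElem?, Array.getElem?_ofFn]
  simp only [ha', dif_pos, Option.getD_some]
  rw [testBit_maskOfN, Nat.one_shiftLeft]

/-- Bits of `cmpT[a]`: the codes comparable with `a`. [this work] -/
theorem testBit_cmpT {a : ℕ} (ha : a < 2 ^ m) (b : ℕ) :
    ((mkTabs m).cmpT.getD a 0).testBit b = (decide (b < 2 ^ m) && (sub b a || sub a b)) := by
  have h1 : (mkTabs m).cmpT = Array.ofFn fun a : Fin (1 <<< m) => maskOfN (1 <<< m) fun b => sub b a || sub a b := rfl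
  have ha' : a < 1 <<< m := by rw [Nat.one_shiftLeft]; exact ha
  rw [h1, Array.getD_eq_getD_getElem?, Array.getElem?_ofFn]
  simp only [ha', dif_pos, Option.getD_some]
  rw [testBit_maskOfN, Nat.one_shiftLeft]

/-- Bits of `nextT[a]`: the larger codes incomparable with `a`. [this work] -/
theorem testBit_nextT {a : ℕ} (ha : a < 2 ^ m) (b : ℕ) :
    ((mkTabs m).nextT.getD a 0).testBit b = (decide (b < 2 ^ m) && (decide (a < b) && !(sub b a) && !(sub a b))) := by
  have h1 : (mkTabs m).nextT = Array.ofFn fun a : Fin (1 <<< m) => maskOfN (1 <<< m) fun b => decide (a.val < b) && !(sub b a) && !(sub a b) := rfl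
  have ha' : a < 1 <<< m := by rw [Nat.one_shiftLeft]; exact ha
  rw [h1, Array.getD_eq_getD_getElem?, Array.getElem?_ofFn]
  simp only [ha', dif_pos, Option.getD_some]
  rw [testBit_maskOfN]
  simp only [Nat.one_shiftLeft]

/-- Bits of `noBit[i]`: the codes not containing coordinate `i`. [this work] -/
theorem testBit_noBit {i : ℕ} (hi : i < m) (x : ℕ) : ((mkTabs m).noBit.getD i 0).testBit x = (decide (x < 2 ^ m) && !(x.testBit i)) := by
  have h1 : (mkTabs m).noBit = Array.ofFn fun i : Fin m => maskOfN (1 <<< m) fun x => !(x.testBit i) := rfl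
  rw [h1, Array.getD_eq_getD_getElem?, Array.getElem?_ofFn]
  simp only [hi, dif_pos, Option.getD_some]
  rw [testBit_maskOfN, Nat.one_shiftLeft]

/-- The mask of all codes. [this work] -/
theorem full_eq : (mkTabs m).full = 2 ^ (2 ^ m) - 1 := by
  show (1 <<< (1 <<< m)) - 1 = _; rw [Nat.one_shiftLeft, Nat.one_shiftLeft]

/-- Bits of `full`. [this work] -/
theorem testBit_full (y : ℕ) : (mkTabs m).full.testBit y = decide (y < 2 ^ m) := by
  rw [full_eq, Nat.testBit_two_pow_sub_one]

end Tables

/-! ### Unions of table masks -/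

/-- This file's `orTab` is typer gen 31's `SahiGridPattern.Pair43.orTab` (so `Pair43.testBit_orTab` gives its bits after `rw [orTab_eq_pair43]`).
[this work] -/
theorem orTab_eq_pair43 : orTab = SahiGridPattern.Pair43.orTab := rfl

/-- Bits of `orBits`: the union of the table entries of the points of a mask. [this work] -/
theorem testBit_orBits (T : Tabs) (A : Array ℕ) (mask y : ℕ) :
    (orBits T A mask).testBit y = (List.range T.np).any fun a => mask.testBit a && (A.getD a 0).testBit y := by
  unfold orBits
  induction T.np with
  | zero => show (0 : ℕ).testBit y = _; simp
  | succ n ih =>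
    show (if mask.testBit n then foldBelow n (fun a acc => if mask.testBit a then acc ||| A.getD a 0 else acc) 0 ||| A.getD n 0
      else foldBelow n (fun a acc => if mask.testBit a then acc ||| A.getD a 0 else acc) 0).testBit y = _
    rw [List.range_succ, List.any_append, List.any_cons, List.any_nil, Bool.or_false, ← ih]
    cases mask.testBit n <;> simp [Nat.testBit_or]

/-! ### The lowest set bit -/

/-- This file's `lowBit` is typer gen 31's `SahiGridPattern.Pair43.lowBit` (so `Pair43.lowBit_spec` applies after `rw [lowBit_eq_pair43]`).
[this work] -/
theorem lowBit_eq_pair43 : lowBit = SahiGridPattern.Pair43.lowBit := rfl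

/-- The lowest set bit of a mask below `2^n` is `< n`. [this work] -/
theorem lowBit_lt {c n : ℕ} (hc : c ≠ 0) (hcn : c < 2 ^ n) : lowBit c < n := by
  rw [lowBit_eq_pair43]
  by_contra h
  have := (lowBit_spec hc).1
  rw [Nat.testBit_lt_two_pow (lt_of_lt_of_le hcn (Nat.pow_le_pow_right (by norm_num) (not_lt.1 h)))] at this
  exact Bool.false_ne_true this

end Summit.CriticalPhenomena.PercolationContinuityZ3.Theorems.ThreePartition.Cube
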